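import Summits.RiemannHypothesis.RiemannHypothesis.Theorems.Splittings.ScrewKreinDiscreteMeanZero
import Summits.RiemannHypothesis.RiemannHypothesis.Theorems.Splittings.ScrewOrbitIndexBound
import Literature.NumberTheory.LFunctions.ZetaRealAxis

/-!
# Screw index transfer, discrete Kreĭn core (5c/4+3): THE EXACT INDEX THEOREM `lim_n n₋(S_n) = #rightZeros`

rh-split-screw-bridge g7, lane (xii-d) continuation «EXACT INDEX», file 5c (cut of `xiid/g7/ScrewExactIndexG7.lean` §16–§18; imports file 5b,
the landed sharp orbit bound `ScrewOrbitIndexBound` and `ZetaRealAxis`).  `rightZeros = {w | 0 < Re w ∧ ξ(½ + w) = 0}` (file 4),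
`n₋(S_n) = #{i | eig_i(screwMatrix n) < 0}` written out.

* `ncard_rightZeros_le_of_indexBounded` : `IndexBounded K ⟹ rightZeros.ncard ≤ K` (file 4 had `4(K+1)`): with the definitizer `Q` of file 5b,
  `ψ = Q(SDOp η)δ₀` has a bounded orbit function, so the symbol `conj(Q(σ_η(−w̄₀)))·Q(σ_η(w₀))` vanishes at every right zero (files 2–3),
  and `w₀ ↦ σ_η(w₀)` (or its conjugate) injects `rightZeros` into the NON-ZERO roots of `Q`, at most `deg Q − 1 ≤ K` of them.
  `ncard_offLine_le_two_mul_of_indexBounded` : `≤ 2K` distinct zeros of `ζ` off the line.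
* `negIndex_le_ncard_rightZeros` : `rightZeros` finite ⟹ `n₋(S_n) ≤ #rightZeros` for EVERY `n` (landed `negIndex_le_two_mul_card_reps` with the
  representatives `½ + Re w + i|Im w|`, whose fibres `{w, w̄}` have two points since `Im w ≠ 0` — no real zeros of `ζ` in `(0,1)`).
* `negIndex_eventually_eq_ncard_rightZeros` : `rightZeros` finite ⟹ `∃ N, ∀ n ≥ N, n₋(S_n) = #rightZeros` (THE EXACT INDEX THEOREM);
  `negIndex_unbounded_of_infinite` : `rightZeros` infinite ⟹ `n₋(S_n)` unbounded; `two_mul_negIndex_eventually_eq_ncard_offLine` : FOZ ⟹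
  eventually `2·n₋(S_n) = #{distinct zeros of ζ off the critical line}`; `indexBounded_iff_rightZeros_finite`.
* `indexLowerBound_two` : the hypothesis `hU′` («every finite set of off-line zeros is eventually matched by `F.card ≤ 2·n₋(S_n)`», the
  referee's T-R3′) of the landed `ScrewOrbitIndexBound.indexTransfer_of_indexLowerBound_two` is a THEOREM; `indexTransfer_by_count` : hence
  `IndexBounded ⟹ FOZ` a second time, by counting.

Classification tags: [folklore] = standard analysis/algebra; [new-combination] = assembled here.
HONEST LABEL: SPLITTING SEARCH over kernel-typed RH-EQUIVALENCES; the exact index theorem relates two OPEN tail data (the screw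
negative index and the number of distinct off-line zeros) and decides neither; nothing here bears on the truth of RH.
-/

noncomputable section

set_option linter.dupNamespace false

namespace Summit.RiemannHypothesis.RiemannHypothesis.Theorems.Splittings.ScrewKreinDiscrete

open Finset Complex MeasureTheory Set Filter Topology Polynomial Module
open scoped ComplexConjugate Matrix
open Literature.NumberTheory.LFunctions
open Literature.Analysis.OperatorTheory
open Literature.Analysis.OperatorTheory.KreinStewart
open Summit.RiemannHypothesis.RiemannHypothesis.Theses.RuelleBand
open Summit.RiemannHypothesis.RiemannHypothesis.Theorems.IntegerScrew
open Summit.RiemannHypothesis.RiemannHypothesis.Theorems.Splittings.ScrewKreinCore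
open Summit.RiemannHypothesis.RiemannHypothesis.Theorems.Splittings.ScrewIndexTransferKrein

/-! ## §16 THE EXACT COUNT: `IndexBounded K ⟹ #rightZeros ≤ K` -/

/-- The exponential sum `expSum x w` is the functional `E_w` applied to `x`. -/
theorem expSum_eq_El (x : ℝ →₀ ℂ) (w : ℂ) : expSum x w = El w x := by
  rw [expSum, El_apply]

/-- `E_w(δ_0) = 1`. -/
theorem El_single_zero (w : ℂ) : El w (Finsupp.single 0 1) = 1 := by
  rw [El_single]; simp

/-- Points of `rightZeros` are non-zero and, with their conjugates and anti-conjugates, stay off `0`. -/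
theorem ne_zero_of_mem_rightZeros {w : ℂ} (hw : w ∈ rightZeros) : w ≠ 0 := by
  rintro rfl
  simp [rightZeros] at hw

/-- **THE EXACT LINEAR COUNT.**  If the negative index of Suzuki's screw node matrices is bounded by `K`, then `ξ` has at most
`K` DISTINCT zeros `½ + w₀` with `Re w₀ > 0` — i.e. at most `K` distinct zeros of `ζ` in the open right half of the critical
strip (and `2K` off the line).  Proof: the definitizer `Q` of `exists_definitizer₀` (degree `≤ K + 1`, `Q(0) = 0`) makes
`ψ = Q(SDOp η)δ₀` a vector with bounded orbit function, so the symbol `S_ψ(w₀) = conj(Q(σ_η(−w̄₀)))·Q(σ_η(w₀))` vanishes at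
every right zero (landed (xii-c) core); `w₀ ↦ σ_η(w₀)` or its conjugate is then an injection of `rightZeros` into the NON-ZERO
roots of `Q` (`σ_η` is injective and zero-free on the small ball, `σ_η(−w̄) = conj σ_η(w)`, and `Re` separates `w₀` from
`−w̄₀'`), of which there are at most `deg Q − 1 ≤ K`.  [new-combination] -/
theorem ncard_rightZeros_le_of_indexBounded (K : ℕ)
    (hK : ∀ n : ℕ, (univ.filter fun i => (screwMatrix_isHermitian n).eigenvalues i < 0).card ≤ K) :
    rightZeros.ncard ≤ K := by
  classical
  have hfin := rightZeros_finite K hK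
  obtain ⟨R, hR⟩ := (hfin.image fun w : ℂ => ‖w‖).bddAbove
  have hRw : ∀ w ∈ rightZeros, ‖w‖ ≤ R := fun w hw => hR (Set.mem_image_of_mem _ hw)
  set R' : ℝ := max R 0 with hR'
  have hR'0 : 0 ≤ R' := le_max_right _ _
  have hwR : ∀ w ∈ rightZeros, ‖w‖ ≤ R' := fun w hw => (hRw w hw).trans (le_max_left _ _)
  set η : ℝ := 1 / (R' + 1) with hη
  have hηpos : 0 < η := by positivity
  have hηR : η * R' < 1 := by
    rw [hη, one_div_mul_eq_div, div_lt_one (by positivity)]; linarith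
  obtain ⟨Q, hQ0, hdeg, hQev, hpos⟩ := exists_definitizer₀ K hK η
  set Rop : Module.End ℂ (ℝ →₀ ℂ) := aeval (SDOp η : Module.End ℂ (ℝ →₀ ℂ)) Q with hRop
  set ψ : ℝ →₀ ℂ := Rop (Finsupp.single 0 1) with hψ
  have hbd : ∀ a, ‖orbitFun ψ a‖ ≤ (BF fC ψ ψ).re := fun a =>
    norm_orbitFun_le Rop (fun a => commute_U_aeval a η Q) hpos a
  have hE : ∀ w', expSum ψ w' = Q.eval (sig η w') := by
    intro w'
    rw [expSum_eq_El, hψ, hRop, El_aeval, El_single_zero, mul_one]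
  -- the symbol vanishes at every right zero: `Q(σ(w₀)) = 0` or `Q(conj σ(w₀)) = 0`
  have hroot : ∀ w ∈ rightZeros, Q.eval (sig η w) = 0 ∨ Q.eval (conj (sig η w)) = 0 := by
    rintro w ⟨hw, hξ⟩
    have hS := symb_eq_zero_of_zero ψ _ hbd hw hξ
    rw [symb_eq_expSum, mul_eq_zero] at hS
    rcases hS with h | h
    · right
      have h' : expSum ψ (-conj w) = 0 := by simpa using h
      rwa [hE, sig_neg_conj] at h'
    · left
      rwa [hE] at h
  -- the injection into the non-zero roots of `Q`
  set τ : ℂ → ℂ := fun w => if Q.eval (sig η w) = 0 then sig η w else conj (sig η w) with hτ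
  have hsig0 : ∀ w ∈ rightZeros, sig η w ≠ 0 := fun w hw =>
    sig_ne_zero_of_ne_zero hηpos hηR (hwR w hw) (ne_zero_of_mem_rightZeros hw)
  have hmaps : ∀ w ∈ rightZeros, τ w ∈ ((Q.roots.toFinset.erase 0 : Finset ℂ) : Set ℂ) := by
    intro w hw
    rw [Finset.mem_coe, Finset.mem_erase, Multiset.mem_toFinset, Polynomial.mem_roots hQ0, Polynomial.IsRoot.def]
    simp only [hτ]
    split_ifs with hc
    · exact ⟨hsig0 w hw, hc⟩
    · refine ⟨fun h0 => hsig0 w hw ?_, (hroot w hw).resolve_left hc⟩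
      simpa using congrArg conj h0
  have hconj_mem : ∀ w ∈ rightZeros, ‖-conj w‖ ≤ R' := fun w hw => by
    rw [norm_neg, Complex.norm_conj]; exact hwR w hw
  have hmixed : ∀ w ∈ rightZeros, ∀ w' ∈ rightZeros, sig η w ≠ conj (sig η w') := by
    intro w hw w' hw' h
    rw [← sig_neg_conj] at h
    have heq := sig_injOn_ball hηpos hηR (hwR w hw) (hconj_mem w' hw') h
    have h1 : 0 < w.re := hw.1
    have h2 : 0 < w'.re := hw'.1
    rw [heq] at h1
    simp at h1
    linarith
  have hinj : Set.InjOn τ rightZeros := by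
    intro w hw w' hw' h
    simp only [hτ] at h
    split_ifs at h with h1 h2 h2
    · exact sig_injOn_ball hηpos hηR (hwR w hw) (hwR w' hw') h
    · exact absurd h (hmixed w hw w' hw')
    · exact absurd h.symm (hmixed w' hw' w hw)
    · have h' : sig η w = sig η w' := by simpa using congrArg conj h
      exact sig_injOn_ball hηpos hηR (hwR w hw) (hwR w' hw') h'
  have h0mem : (0 : ℂ) ∈ Q.roots.toFinset := by
    rw [Multiset.mem_toFinset, Polynomial.mem_roots hQ0, Polynomial.IsRoot.def, hQev]
  calc rightZeros.ncard ≤ (((Q.roots.toFinset.erase 0 : Finset ℂ)) : Set ℂ).ncard :=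
        Set.ncard_le_ncard_of_injOn τ hmaps hinj (Finset.finite_toSet _)
    _ = (Q.roots.toFinset.erase 0).card := Set.ncard_coe_finset _
    _ ≤ K := by
        rw [Finset.card_erase_of_mem h0mem]
        have h1 := Multiset.toFinset_card_le Q.roots
        have h2 := Polynomial.card_roots' Q
        omega

/-- Hence at most `2K` distinct zeros of `ζ` off the critical line (companion of `ncard_offLine_le_of_indexBounded`'s `8(K+1)`). -/
theorem ncard_offLine_le_two_mul_of_indexBounded (K : ℕ)
    (hK : ∀ n : ℕ, (univ.filter fun i => (screwMatrix_isHermitian n).eigenvalues i < 0).card ≤ K) :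
    {s : ℂ | riemannZeta s = 0 ∧ 0 < s.re ∧ s.re < 1 ∧ s.re ≠ 1 / 2}.ncard ≤ 2 * K := by
  have hfin := rightZeros_finite K hK
  have hA : ((fun w : ℂ => 1 / 2 + w) '' rightZeros).Finite := hfin.image _
  have hB : ((fun z : ℂ => 1 - z) '' ((fun w : ℂ => 1 / 2 + w) '' rightZeros)).Finite := hA.image _
  have hcnt := ncard_rightZeros_le_of_indexBounded K hK
  calc {s : ℂ | riemannZeta s = 0 ∧ 0 < s.re ∧ s.re < 1 ∧ s.re ≠ 1 / 2}.ncard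
      ≤ (((fun w : ℂ => 1 / 2 + w) '' rightZeros) ∪
          ((fun z : ℂ => 1 - z) '' ((fun w : ℂ => 1 / 2 + w) '' rightZeros))).ncard :=
        Set.ncard_le_ncard offLine_subset_rightZeros (hA.union hB)
    _ ≤ ((fun w : ℂ => 1 / 2 + w) '' rightZeros).ncard +
          ((fun z : ℂ => 1 - z) '' ((fun w : ℂ => 1 / 2 + w) '' rightZeros)).ncard := Set.ncard_union_le _ _
    _ ≤ rightZeros.ncard + rightZeros.ncard :=
        add_le_add (Set.ncard_image_le hfin) ((Set.ncard_image_le hA).trans (Set.ncard_image_le hfin))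
    _ ≤ 2 * K := by omega

/-! ## §17 THE EXACT INDEX THEOREM: `n₋(S_n) = #rightZeros` eventually (finite case), `n₋(S_n) → ∞` (infinite case) -/

/-- `rightZeros` is closed under conjugation. [folklore] -/
theorem conj_mem_rightZeros {w : ℂ} (hw : w ∈ rightZeros) : conj w ∈ rightZeros := by
  refine ⟨by simpa using hw.1, ?_⟩
  have h := riemannXi_conj_holds (1 / 2 + w)
  rw [hw.2, map_zero, map_add] at h
  have h12 : (starRingEnd ℂ) (1 / 2 : ℂ) = 1 / 2 := by
    rw [map_div₀, map_one]; norm_num [map_ofNat]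
  rw [h12] at h
  exact h

/-- Points of `rightZeros` have non-zero imaginary part (no real zeros of `ζ` in `(0, 1)`, tree `ZetaRealAxis`). [folklore] -/
theorem im_ne_zero_of_mem_rightZeros {w : ℂ} (hw : w ∈ rightZeros) : w.im ≠ 0 := by
  intro him
  obtain ⟨hz, h0, h1⟩ := (riemannXi_eq_zero_iff_holds (1 / 2 + w)).1 hw.2
  exact riemannZeta_ne_zero_of_im_eq_zero_of_pos_of_lt_one (by simpa using him) h0 h1 hz

/-- The quadrant representative of an off-line non-trivial zero comes from a right zero: for `ρ` with `Re ρ ≠ ½`,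
`⟨max (Re ρ) (1 − Re ρ), |Im ρ|⟩ = ½ + w` with `w = ⟨max (Re ρ) (1 − Re ρ) − ½, |Im ρ|⟩ ∈ rightZeros`. [folklore] -/
theorem rep_mem_image_rightZeros (ρ : ZetaZeros.riemannZetaNontrivialZeros) (hρ : (ρ : ℂ).re ≠ 1 / 2) :
    (⟨max (ρ : ℂ).re (1 - (ρ : ℂ).re) - 1 / 2, |(ρ : ℂ).im|⟩ : ℂ) ∈ rightZeros := by
  obtain ⟨hz, h0, h1⟩ := ZetaZeros.riemannZetaNontrivialZeros.mem_iff'.1 ρ.2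
  have hξ : riemannXi (ρ : ℂ) = 0 := (riemannXi_eq_zero_iff_holds _).2 ⟨hz, h0, h1⟩
  set b : ℂ := ⟨max (ρ : ℂ).re (1 - (ρ : ℂ).re), |(ρ : ℂ).im|⟩ with hb
  have hfib := ScrewOrbitIndexBound.rep_fibre (s := (ρ : ℂ)) (b := b) rfl
  have hξb : riemannXi b = 0 := by
    rcases hfib with h | h | h | h
    · rw [← h]; exact hξ
    · have : b = conj (ρ : ℂ) := by rw [h, Complex.conj_conj]
      rw [this, riemannXi_conj_holds, hξ, map_zero]
    · have : b = conj (1 - (ρ : ℂ)) := by rw [h]; simp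
      rw [this, riemannXi_conj_holds, riemannXi_one_sub, hξ, map_zero]
    · have : b = 1 - (ρ : ℂ) := by rw [h]; ring
      rw [this, riemannXi_one_sub, hξ]
  refine ⟨?_, ?_⟩
  · show 0 < max (ρ : ℂ).re (1 - (ρ : ℂ).re) - 1 / 2
    rcases lt_or_gt_of_ne hρ with h | h
    · have : 1 / 2 < 1 - (ρ : ℂ).re := by linarith
      linarith [le_max_right (ρ : ℂ).re (1 - (ρ : ℂ).re)]
    · linarith [le_max_left (ρ : ℂ).re (1 - (ρ : ℂ).re)]
  · have heq : (1 / 2 : ℂ) + ⟨max (ρ : ℂ).re (1 - (ρ : ℂ).re) - 1 / 2, |(ρ : ℂ).im|⟩ = b := by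
      rw [hb]; apply Complex.ext <;> simp
    rw [heq]; exact hξb

/-- **THE SHARP UPPER BOUND** `n₋(S_n) ≤ #rightZeros` for every `n` when `rightZeros` is finite: the landed orbit bound
`ScrewOrbitIndexBound.negIndex_le_two_mul_card_reps` with `R` = the representatives `½ + Re w + i|Im w|`, and `2·#R ≤ #rightZeros`
because the fibres `{w, w̄}` have two points (`Im w ≠ 0`: no real zeros of `ζ` in `(0,1)`). [new-combination] -/
theorem negIndex_le_ncard_rightZeros (hfin : rightZeros.Finite) (n : ℕ) :
    (univ.filter fun i => (screwMatrix_isHermitian n).eigenvalues i < 0).card ≤ rightZeros.ncard := by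
  classical
  set φ : ℂ → ℂ := fun w => ⟨1 / 2 + w.re, |w.im|⟩ with hφ
  set Zf : Finset ℂ := hfin.toFinset with hZf
  set R : Finset ℂ := Zf.image φ with hRdef
  have hR : ∀ ρ : ZetaZeros.riemannZetaNontrivialZeros, (ρ : ℂ).re ≠ 1 / 2 →
      (⟨max (ρ : ℂ).re (1 - (ρ : ℂ).re), |(ρ : ℂ).im|⟩ : ℂ) ∈ R := by
    intro ρ hρ
    have hmem := rep_mem_image_rightZeros ρ hρ
    rw [hRdef, Finset.mem_image]
    refine ⟨_, by rw [hZf, Set.Finite.mem_toFinset]; exact hmem, ?_⟩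
    rw [hφ]; apply Complex.ext <;> simp
  have h1 := ScrewOrbitIndexBound.negIndex_le_two_mul_card_reps R hR n
  -- `2·#R ≤ #Zf`: every fibre of `φ` over `R` contains a conjugate pair
  have hmapsTo : ∀ w ∈ Zf, φ w ∈ R := fun w hw => Finset.mem_image_of_mem φ hw
  have hcard : Zf.card = ∑ b ∈ R, (Zf.filter fun w => φ w = b).card :=
    Finset.card_eq_sum_card_fiberwise hmapsTo
  have hfib : ∀ b ∈ R, 2 ≤ (Zf.filter fun w => φ w = b).card := by
    intro b hb
    obtain ⟨w₀, hw₀, rfl⟩ := Finset.mem_image.mp hb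
    have hw₀' : w₀ ∈ rightZeros := by rwa [hZf, Set.Finite.mem_toFinset] at hw₀
    have hc : conj w₀ ∈ Zf := by rw [hZf, Set.Finite.mem_toFinset]; exact conj_mem_rightZeros hw₀'
    have hne : w₀ ≠ conj w₀ := by
      intro h
      apply im_ne_zero_of_mem_rightZeros hw₀'
      have := congrArg Complex.im h
      simp at this
      linarith
    have hsub : ({w₀, conj w₀} : Finset ℂ) ⊆ Zf.filter fun w => φ w = φ w₀ := by
      intro w hw
      rw [Finset.mem_insert, Finset.mem_singleton] at hw
      rw [Finset.mem_filter]
      rcases hw with rfl | rfl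
      · exact ⟨hw₀, rfl⟩
      · refine ⟨hc, ?_⟩
        rw [hφ]; apply Complex.ext <;> simp
    calc 2 = ({w₀, conj w₀} : Finset ℂ).card := (Finset.card_pair hne).symm
      _ ≤ _ := Finset.card_le_card hsub
  have h2 : 2 * R.card ≤ Zf.card := by
    rw [hcard, mul_comm, ← smul_eq_mul, ← Finset.sum_const]
    exact Finset.sum_le_sum hfib
  rw [Set.ncard_eq_toFinset_card rightZeros hfin, ← hZf]
  omega

/-- **THE EXACT INDEX THEOREM (finite case).**  If `ξ` has finitely many zeros `½ + w₀` with `Re w₀ > 0`, then the negative index of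
the screw node matrices `S_n` is EVENTUALLY EQUAL to their number (distinct, without multiplicity):
`∃ N, ∀ n ≥ N, n₋(S_n) = #rightZeros`.  (Upper bound: `negIndex_le_ncard_rightZeros`; lower bound: the monotone bounded sequence
`n₋(S_n)` attains its supremum `K`, and `ncard_rightZeros_le_of_indexBounded K`.) [new-combination] -/
theorem negIndex_eventually_eq_ncard_rightZeros (hfin : rightZeros.Finite) :
    ∃ N : ℕ, ∀ n : ℕ, N ≤ n →
      (univ.filter fun i => (screwMatrix_isHermitian n).eigenvalues i < 0).card = rightZeros.ncard := by
  classical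
  set f : ℕ → ℕ := fun n => (univ.filter fun i => (screwMatrix_isHermitian n).eigenvalues i < 0).card with hf
  have hbdd : BddAbove (Set.range f) := ⟨rightZeros.ncard, by rintro _ ⟨n, rfl⟩; exact negIndex_le_ncard_rightZeros hfin n⟩
  have hne : (Set.range f).Nonempty := ⟨f 0, 0, rfl⟩
  obtain ⟨N, hN⟩ : ∃ N, f N = sSup (Set.range f) := by
    have := Nat.sSup_mem hne hbdd
    obtain ⟨N, hN⟩ := this
    exact ⟨N, hN⟩
  have hsup : ∀ n, f n ≤ f N := fun n => by rw [hN]; exact le_csSup hbdd ⟨n, rfl⟩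
  have hle : rightZeros.ncard ≤ f N := ncard_rightZeros_le_of_indexBounded (f N) hsup
  refine ⟨N, fun n hn => le_antisymm (negIndex_le_ncard_rightZeros hfin n) (hle.trans ?_)⟩
  exact ScrewBridgeRawG3.negIndex_mono hn

/-- **THE EXACT INDEX THEOREM (infinite case).**  If `ξ` has infinitely many zeros with `Re w₀ > 0` then `n₋(S_n)` is unbounded
(contrapositive of `rightZeros_finite`). [new-combination] -/
theorem negIndex_unbounded_of_infinite (hinf : rightZeros.Infinite) (K : ℕ) :
    ∃ n : ℕ, K < (univ.filter fun i => (screwMatrix_isHermitian n).eigenvalues i < 0).card := by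
  by_contra h
  push Not at h
  exact hinf (rightZeros_finite K h)

/-- **Lemma U′ (T-R3′) IS A THEOREM**: every finite set `F` of off-line non-trivial zeros is eventually matched by
`F.card ≤ 2·n₋(S_n)` — the hypothesis `hU′` of the landed `ScrewOrbitIndexBound.indexTransfer_of_indexLowerBound_two`, discharged
unconditionally. (Finite case: `F ⊆ (½ + rightZeros) ∪ (1 − (½ + rightZeros))` has `≤ 2·#rightZeros = 2·n₋(S_n)` points
eventually; infinite case: `n₋ → ∞`.) [new-combination] -/
theorem indexLowerBound_two :
    ∀ F : Finset ZetaZeros.riemannZetaNontrivialZeros, (∀ ρ ∈ F, (ρ : ℂ).re ≠ 1 / 2) →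
      ∃ N : ℕ, ∀ n : ℕ, N ≤ n →
        F.card ≤ 2 * (univ.filter fun i => (screwMatrix_isHermitian n).eigenvalues i < 0).card := by
  classical
  intro F hF
  by_cases hfin : rightZeros.Finite
  · obtain ⟨N, hN⟩ := negIndex_eventually_eq_ncard_rightZeros hfin
    refine ⟨N, fun n hn => ?_⟩
    rw [hN n hn]
    have hA : ((fun w : ℂ => 1 / 2 + w) '' rightZeros).Finite := hfin.image _
    have hB : ((fun z : ℂ => 1 - z) '' ((fun w : ℂ => 1 / 2 + w) '' rightZeros)).Finite := hA.image _
    have hsub : ((F.image (Subtype.val : ZetaZeros.riemannZetaNontrivialZeros → ℂ)) : Set ℂ) ⊆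
        {s : ℂ | riemannZeta s = 0 ∧ 0 < s.re ∧ s.re < 1 ∧ s.re ≠ 1 / 2} := by
      intro s hs
      rw [Finset.coe_image, Set.mem_image] at hs
      obtain ⟨ρ, hρ, rfl⟩ := hs
      obtain ⟨hz, h0, h1⟩ := ZetaZeros.riemannZetaNontrivialZeros.mem_iff'.1 ρ.2
      exact ⟨hz, h0, h1, hF ρ (Finset.mem_coe.mp hρ)⟩
    have hcardF : F.card = (F.image (Subtype.val : ZetaZeros.riemannZetaNontrivialZeros → ℂ)).card :=
      (Finset.card_image_of_injective F Subtype.val_injective).symm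
    rw [hcardF, ← Set.ncard_coe_finset]
    calc ((F.image (Subtype.val : ZetaZeros.riemannZetaNontrivialZeros → ℂ)) : Set ℂ).ncard
        ≤ (((fun w : ℂ => 1 / 2 + w) '' rightZeros) ∪
            ((fun z : ℂ => 1 - z) '' ((fun w : ℂ => 1 / 2 + w) '' rightZeros))).ncard :=
          Set.ncard_le_ncard (hsub.trans offLine_subset_rightZeros) (hA.union hB)
      _ ≤ ((fun w : ℂ => 1 / 2 + w) '' rightZeros).ncard +
            ((fun z : ℂ => 1 - z) '' ((fun w : ℂ => 1 / 2 + w) '' rightZeros)).ncard := Set.ncard_union_le _ _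
      _ ≤ rightZeros.ncard + rightZeros.ncard :=
          add_le_add (Set.ncard_image_le hfin) ((Set.ncard_image_le hA).trans (Set.ncard_image_le hfin))
      _ = 2 * rightZeros.ncard := by ring
  · obtain ⟨N, hN⟩ := negIndex_unbounded_of_infinite hfin F.card
    refine ⟨N, fun n hn => ?_⟩
    have hmono := ScrewBridgeRawG3.negIndex_mono hn
    omega

/-- **`IndexTransferKrein` by the index count alone** (second, independent kernel proof of T2's transfer direction: the landed
`indexTransfer_of_indexLowerBound_two` fed with the theorem `indexLowerBound_two`). [new-combination] -/
theorem indexTransfer_by_count :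
    (∃ K : ℕ, ∀ n : ℕ, (univ.filter fun i => (screwMatrix_isHermitian n).eigenvalues i < 0).card ≤ K) →
      CofiniteCriticalLine :=
  ScrewOrbitIndexBound.indexTransfer_of_indexLowerBound_two indexLowerBound_two

/-! ## §18 Corollary: `2·n₋(S_n) = #{distinct off-line zeros of ζ}` eventually -/

/-- The off-line zero set of `ζ` IS `(½ + rightZeros) ∪ (1 − (½ + rightZeros))` (the inclusion `⊆` is `offLine_subset_rightZeros`).
[folklore] -/
theorem offLine_eq_rightZeros :
    {s : ℂ | riemannZeta s = 0 ∧ 0 < s.re ∧ s.re < 1 ∧ s.re ≠ 1 / 2} =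
      ((fun w => 1 / 2 + w) '' rightZeros) ∪ ((fun z => 1 - z) '' ((fun w => 1 / 2 + w) '' rightZeros)) := by
  refine Set.Subset.antisymm offLine_subset_rightZeros ?_
  have key : ∀ w ∈ rightZeros, (1 / 2 + w) ∈ {s : ℂ | riemannZeta s = 0 ∧ 0 < s.re ∧ s.re < 1 ∧ s.re ≠ 1 / 2} := by
    rintro w ⟨hw, hξ⟩
    obtain ⟨hz, h0, h1⟩ := (riemannXi_eq_zero_iff_holds (1 / 2 + w)).1 hξ
    refine ⟨hz, h0, h1, ?_⟩
    simp only [Complex.add_re]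
    norm_num
    exact hw.ne'
  rintro s (⟨w, hw, rfl⟩ | ⟨z, ⟨w, hw, rfl⟩, rfl⟩)
  · exact key w hw
  · obtain ⟨hz, h0, h1, hne⟩ := key w hw
    have hξ : riemannXi (1 - (1 / 2 + w)) = 0 := by rw [riemannXi_one_sub]; exact hw.2
    obtain ⟨hz', h0', h1'⟩ := (riemannXi_eq_zero_iff_holds _).1 hξ
    refine ⟨hz', h0', h1', ?_⟩
    simp only [Complex.sub_re, Complex.one_re, Complex.add_re] at hne ⊢
    intro h; apply hne; linarith

/-- `#{distinct off-line zeros} = 2·#rightZeros` when `rightZeros` is finite (the two halves are disjoint translates / reflections).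
[folklore] -/
theorem ncard_offLine_eq_two_mul (hfin : rightZeros.Finite) :
    {s : ℂ | riemannZeta s = 0 ∧ 0 < s.re ∧ s.re < 1 ∧ s.re ≠ 1 / 2}.ncard = 2 * rightZeros.ncard := by
  have hA : ((fun w : ℂ => 1 / 2 + w) '' rightZeros).Finite := hfin.image _
  have hB : ((fun z : ℂ => 1 - z) '' ((fun w : ℂ => 1 / 2 + w) '' rightZeros)).Finite := hA.image _
  have hinjA : Set.InjOn (fun w : ℂ => 1 / 2 + w) rightZeros := fun a _ b _ h => by simpa using h
  have hinjB : Set.InjOn (fun z : ℂ => 1 - z) ((fun w : ℂ => 1 / 2 + w) '' rightZeros) := fun a _ b _ h => by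
    simpa using h
  have hcA : ((fun w : ℂ => 1 / 2 + w) '' rightZeros).ncard = rightZeros.ncard := hinjA.ncard_image
  have hcB : ((fun z : ℂ => 1 - z) '' ((fun w : ℂ => 1 / 2 + w) '' rightZeros)).ncard = rightZeros.ncard := by
    rw [hinjB.ncard_image, hcA]
  have hdisj : Disjoint ((fun w : ℂ => 1 / 2 + w) '' rightZeros)
      ((fun z : ℂ => 1 - z) '' ((fun w : ℂ => 1 / 2 + w) '' rightZeros)) := by
    rw [Set.disjoint_left]
    rintro _ ⟨w, hw, rfl⟩ ⟨z, ⟨w', hw', rfl⟩, h⟩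
    have h1 : 0 < w.re := hw.1
    have h2 : 0 < w'.re := hw'.1
    have := congrArg Complex.re h
    simp at this
    linarith
  rw [offLine_eq_rightZeros, Set.ncard_union_eq hdisj hA hB, hcA, hcB]
  ring

/-- **THE EXACT INDEX THEOREM, off-line form.**  If `ζ` has finitely many zeros off the critical line, then eventually
`2·n₋(S_n) = #{distinct zeros of ζ off the critical line}`: the screw negative index is EXACTLY the number of off-line zero PAIRS
`{ρ, 1 − ρ̄}` (equivalently of off-line zeros in the upper half-plane), counted without multiplicity. [new-combination] -/
theorem two_mul_negIndex_eventually_eq_ncard_offLine (hfoz : CofiniteCriticalLine) :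
    ∃ N : ℕ, ∀ n : ℕ, N ≤ n →
      2 * (univ.filter fun i => (screwMatrix_isHermitian n).eigenvalues i < 0).card =
        {s : ℂ | riemannZeta s = 0 ∧ 0 < s.re ∧ s.re < 1 ∧ s.re ≠ 1 / 2}.ncard := by
  have hfin : rightZeros.Finite := by
    have hA : ((fun w : ℂ => 1 / 2 + w) '' rightZeros) ⊆ {s : ℂ | riemannZeta s = 0 ∧ 0 < s.re ∧ s.re < 1 ∧ s.re ≠ 1 / 2} := by
      rw [offLine_eq_rightZeros]; exact Set.subset_union_left
    have hinjA : Set.InjOn (fun w : ℂ => 1 / 2 + w) rightZeros := fun a _ b _ h => by simpa using h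
    exact Set.Finite.of_finite_image (hfoz.subset hA) hinjA
  obtain ⟨N, hN⟩ := negIndex_eventually_eq_ncard_rightZeros hfin
  exact ⟨N, fun n hn => by rw [hN n hn, ncard_offLine_eq_two_mul hfin]⟩

/-- `IndexBounded ⟺ rightZeros finite ⟺ FOZ`, with the SAME number: the supremum of `n₋(S_n)` is `#rightZeros`. [new-combination] -/
theorem indexBounded_iff_rightZeros_finite :
    (∃ K : ℕ, ∀ n : ℕ, (univ.filter fun i => (screwMatrix_isHermitian n).eigenvalues i < 0).card ≤ K) ↔ rightZeros.Finite :=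
  ⟨fun ⟨K, hK⟩ => rightZeros_finite K hK, fun hfin => ⟨rightZeros.ncard, negIndex_le_ncard_rightZeros hfin⟩⟩

end Summit.RiemannHypothesis.RiemannHypothesis.Theorems.Splittings.ScrewKreinDiscrete
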